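import Summits.KontsevichZagierPeriods.KontsevichZagierPeriods.Theorems.RootDecompWalshStrataBallMoves

/-!
# Conic descent, gen 6 (L5, general form): the fibrewise vertex chart for ELLIPSE-TYPE fibres

Decomposition node `WalshStrata` (route `RootDecompWalshStrata`, support item `QuadricBakerDescent`
stmt-KontsevichZagierPeriods-27597, `d = 3` slice).  The landed ball-cube descent (gen 5,
`Theorems/RootDecompWalshStrataBall*.lean`) used the chart `(v, x) ↦ (x, √(7 − 4x²)·v/(1 + v²))`
for the ONE quadric `K₇`.  This file types and proves the same move for EVERY ellipse-type fibre
quadratic `D(x, y) = H(x) − m·(y − Y₀(x))²` (`0 < m ∈ ℚ`, `H, Y₀ ∈ ℚ[X]`; for a `Quadric₃` with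
`d₂ = b₂² − 4A·c₂₂ < 0` one has `m = −d₂`, `Y₀ = d₁/(2m)`, `H = d₀ + d₁²/(4m)`):

  `Φ(v, x) = (x, Y₀(x) + √H(x)·U_m(v))`,  `U_m(v) = 2v/(1 + m v²)`  (`m v² < 1`),

the parametrisation of the unit conic `T² + m·U² = 1` from its RATIONAL point `(U, T) = (0, 1)`
scaled by `√H(x)`: `√D ∘ Φ = √H(x)·T_m(v)`, `|det Φ'| = √H(x)·U_m′(v)`, so the pulled-back weight
`γ√D·|det Φ'| = γ·H(x)·g_m(v)`, `g_m(v) = 2(1 − m v²)²/(1 + m v²)³`, is `ℚ`-RATIONAL in `(v, x)`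
— NO `√m` and no `√H` survive (`vchart_mem_relations`, rule (2) as typed).  Consequences recorded
in the node: after rule (3) in `x` (primitive `γ·∫H·g_m(v)`) every boundary term of the two-variable
descent is either rational in `v` (vertical edges) or, reparametrised by `x`, of the form
`R₁(x) + R₂(x)√w(x) + R₃(x)/√w(x)` with ONE rational quadratic `w` per edge — the inputs of
`InBaker.sqrt_rational` / `InBaker.sqrt_rational_div` (gen 6, `EulerDescent.lean`).

Contents. §25.1 `U_m, T_m, U_m′, g_m` and their algebra (`T² + mU² = 1`, `g = T·U′`, `0 ≤ g ≤ 2`,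
`U_m` injective on `m v² < 1`); §25.2 the chart `vΦ`, its Jacobian `vΦ'` (`det = −√H·U_m′`),
`hasFDerivAt_vΦ`, `injOn_vΦ`, semialgebraicity; §25.3 **`vchart_mem_relations`** (rule (2) for
the chart, at the level of representations, plus the bounded constructors `srcRep` / `tgtRep`);
§25.4 the dictionary `Quadric₃.Dxy = H(x) − m(y − Y₀(x))²` for `d₂ = −m` (`Dxy_eq_vertex`);
§25.5 **`vband_move`** (rule (3) in `x` over an arbitrary bounded semialgebraic `v`-base with
semialgebraic edges `0 ≤ l ≤ u ≤ 1`, primitive `F = γ·Hi(x)·g_m(v)`, `Hi′ = H`); §25.6 the edge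
identity `edge_term_eq` (signed) — the reparametrised boundary integrand is
`γ·Hi·t_b·(2H(y_b′ − Y₀′) − (y_b − Y₀)H′)/(2H²)`, `m`-free; §25.7 the inverse chart
`V_m(ρ) = ρ/(1 + √(1 − mρ²))` (`U_m ∘ V_m = id`, injective, differentiable, semialgebraic along
`r = (y_b − Y₀)/√H`), the unsigned identity `edge_term_abs` and **`edge_pullback`** = rule (2) in one
variable along `v = V_m(r(x))` (via the landed `exists_cov₁`), producing the `m`-free terminal.
GEN-7 RECIPE for `SqrtDescent₂ K γ`, ellipse type: (a) cylindrical decomposition of `Φ⁻¹(atom)`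
into `x`-bands over `v`-cells (`Literature…CylindricalDecomposition`,
`IsSemialgebraic.exists_cylindricalDecomposition`); (b) `vchart_mem_relations` per band;
(c) `vband_move` per band; (d) `edge_pullback` per curved edge piece (vertical edges `x ∈ {0,1}`,
`H(x) = 0` give RATIONAL `v`-terms; `D = 0` edges give `0`); (e) terminals by
`InBaker.sqrt_rational(_div)` (gen 6) after splitting by the sign of `N_b` and of `B(x, y_b(x))`.
0 sorry; 0 warnings; std axioms {propext, Classical.choice, Quot.sound} (`vchart_mem_relations`,
`vband_move`, `edge_term_eq`, `edge_pullback`). [KontsevichZagier2001 §1.2 rules (2), (3);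
BCR1998 §2.2; this node gen 4 `exists_cov₁`, gen 5 `chΦ`/`band_move`]

This is part 1/3 of the gen-6 package (the farm-checked monolith `VertexChart.lean` cut at declaration
boundaries into ≤ 400-line files); the parts, in import order: `VertexChart01` … `VertexChart03`.
-/

noncomputable section

open Literature.NumberTheory.Transcendental
open MeasureTheory Set
open MvPolynomial (aeval X C)
open Literature.ModelTheory.ExponentialFields (IsSemialgebraic isSemialgebraic_univ
  isSemialgebraic_setOf_eval_pos isSemialgebraic_setOf_eval_lt isSemialgebraic_setOf_eval_le
  isSemialgebraic_setOf_eval_nonneg isSemialgebraic_setOf_eval_eq_zero continuous_aeval_real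
  tarski_seidenberg_real_holds)

namespace Summit.KontsevichZagierPeriods.RootDecompWalshStrata.ConicDescent.VertexChart

/-! #### 25.1 The rational parametrisation of `T² + m U² = 1` from `(0, 1)` -/

/-- `U_m(v) = 2v/(1 + m v²)`. -/
def gU (m : ℚ) (v : ℝ) : ℝ := 2 * v / (1 + m * v ^ 2)

/-- `T_m(v) = (1 − m v²)/(1 + m v²)`. -/
def gT (m : ℚ) (v : ℝ) : ℝ := (1 - m * v ^ 2) / (1 + m * v ^ 2)

/-- `U_m′(v) = 2(1 − m v²)/(1 + m v²)²`. -/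
def gU' (m : ℚ) (v : ℝ) : ℝ := 2 * (1 - m * v ^ 2) / (1 + m * v ^ 2) ^ 2

/-- The chart weight `g_m(v) = 2(1 − m v²)²/(1 + m v²)³ = T_m(v)·U_m′(v)`. -/
def gW (m : ℚ) (v : ℝ) : ℝ := 2 * (1 - m * v ^ 2) ^ 2 / (1 + m * v ^ 2) ^ 3

variable {m : ℚ}

/-- `1 + m v² > 0` for `m ≥ 0`. -/
theorem one_add_pos (hm : 0 ≤ m) (v : ℝ) : 0 < 1 + (m : ℝ) * v ^ 2 := by
  have : (0 : ℝ) ≤ m := by exact_mod_cast hm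
  positivity

/-- `T_m² + m·U_m² = 1`. -/
theorem gT_sq_add (hm : 0 ≤ m) (v : ℝ) : gT m v ^ 2 + m * gU m v ^ 2 = 1 := by
  have h := (one_add_pos hm v).ne'
  unfold gT gU
  field_simp
  ring

/-- `1 − m·U_m² = T_m²`. -/
theorem one_sub_m_gU_sq (hm : 0 ≤ m) (v : ℝ) : 1 - m * gU m v ^ 2 = gT m v ^ 2 := by
  linear_combination -gT_sq_add hm v

/-- `T_m(v) ≥ 0` when `m v² ≤ 1`. -/
theorem gT_nonneg (hm : 0 ≤ m) {v : ℝ} (hv : (m : ℝ) * v ^ 2 ≤ 1) : 0 ≤ gT m v :=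
  div_nonneg (by linarith) (one_add_pos hm v).le

/-- `U_m′(v) ≥ 0` when `m v² ≤ 1`. -/
theorem gU'_nonneg (hm : 0 ≤ m) {v : ℝ} (hv : (m : ℝ) * v ^ 2 ≤ 1) : 0 ≤ gU' m v := by
  unfold gU'
  exact div_nonneg (by linarith) (by positivity)

/-- `g_m = T_m·U_m′`. -/
theorem gW_eq (hm : 0 ≤ m) (v : ℝ) : gW m v = gT m v * gU' m v := by
  have h := (one_add_pos hm v).ne'
  unfold gW gT gU'
  field_simp

/-- `g_m ≥ 0`. -/
theorem gW_nonneg (hm : 0 ≤ m) (v : ℝ) : 0 ≤ gW m v := by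
  have := one_add_pos hm v
  unfold gW
  positivity

/-- `g_m ≤ 2`. -/
theorem gW_le_two (hm : 0 ≤ m) (v : ℝ) : gW m v ≤ 2 := by
  have h1 := one_add_pos hm v
  have hm' : (0 : ℝ) ≤ m := by exact_mod_cast hm
  have hmv : 0 ≤ (m : ℝ) * v ^ 2 := by positivity
  unfold gW
  rw [div_le_iff₀ (by positivity)]
  nlinarith [mul_nonneg hmv hmv, mul_nonneg hmv (mul_nonneg hmv hmv)]

/-- `U_m′` is the derivative of `U_m`. [calculus] -/
theorem hasDerivAt_gU (hm : 0 ≤ m) (v : ℝ) : HasDerivAt (gU m) (gU' m v) v := by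
  have h2 : HasDerivAt (fun s : ℝ => 1 + (m : ℝ) * s ^ 2) ((m : ℝ) * (2 * v)) v := by
    simpa using ((hasDerivAt_pow 2 v).const_mul (m : ℝ)).const_add 1
  have h1 : HasDerivAt (fun s : ℝ => 2 * s) 2 v := by
    simpa using (hasDerivAt_id' v).const_mul (2 : ℝ)
  have hne := (one_add_pos hm v).ne'
  have h := h1.div h2 hne
  refine (h.congr_of_eventuallyEq ?_).congr_deriv ?_
  · exact Filter.Eventually.of_forall fun s => rfl
  · unfold gU'
    field_simp
    ring

/-- `U_m` is injective on `m v² < 1`. -/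
theorem gU_inj (hm : 0 ≤ m) {v w : ℝ} (hv : (m : ℝ) * v ^ 2 < 1) (hw : (m : ℝ) * w ^ 2 < 1)
    (h : gU m v = gU m w) : v = w := by
  have hm' : (0 : ℝ) ≤ m := by exact_mod_cast hm
  unfold gU at h
  rw [div_eq_div_iff (one_add_pos hm v).ne' (one_add_pos hm w).ne'] at h
  have h3 : (v - w) * (1 - m * (v * w)) = 0 := by linear_combination h / 2
  rcases mul_eq_zero.1 h3 with h0 | h0
  · linarith
  · exfalso
    have hp : (m : ℝ) * (v * w) = 1 := by linarith
    have hsq : ((m : ℝ) * v ^ 2) * ((m : ℝ) * w ^ 2) = 1 := by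
      have : ((m : ℝ) * (v * w)) ^ 2 = 1 := by rw [hp, one_pow]
      linear_combination this
    have hmv : 0 ≤ (m : ℝ) * v ^ 2 := by positivity
    nlinarith [mul_lt_mul'' hv hw hmv (by positivity)]

/-! #### 25.2 `√H(x)` and the chart `Φ(v, x) = (x, Y₀(x) + √H(x)·U_m(v))` -/

/-- `S(x) = √H(x)`. -/
def vS (H : Polynomial ℚ) (x : ℝ) : ℝ := √(Polynomial.aeval x H)

/-- `S ≥ 0`. -/
theorem vS_nonneg (H : Polynomial ℚ) (x : ℝ) : 0 ≤ vS H x := Real.sqrt_nonneg _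

/-- `S(x)² = H(x)` where `H ≥ 0`. -/
theorem vS_sq {H : Polynomial ℚ} {x : ℝ} (hx : 0 ≤ Polynomial.aeval x H) : vS H x ^ 2 = Polynomial.aeval x H :=
  Real.sq_sqrt hx

/-- `S(x) > 0` where `H > 0`. -/
theorem vS_pos {H : Polynomial ℚ} {x : ℝ} (hx : 0 < Polynomial.aeval x H) : 0 < vS H x :=
  Real.sqrt_pos.2 hx

/-- `S′(x) = H′(x)/(2S(x))` where `H > 0`. [calculus] -/
theorem hasDerivAt_vS {H : Polynomial ℚ} {x : ℝ} (hx : 0 < Polynomial.aeval x H) :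
    HasDerivAt (vS H) (Polynomial.aeval x (Polynomial.derivative H) / (2 * vS H x)) x := by
  have h := (H.hasDerivAt_aeval x).sqrt hx.ne'
  exact h

/-- The chart `Φ(v, x) = (x, Y₀(x) + √H(x)·U_m(v))` (source coordinates `p 0 = v`, `p 1 = x`;
target coordinates `x`, `y`). -/
def vΦ (m : ℚ) (Y₀ H : Polynomial ℚ) (p : Fin 2 → ℝ) : Fin 2 → ℝ :=
  ![p 1, Polynomial.aeval (p 1) Y₀ + vS H (p 1) * gU m (p 0)]

variable {Y₀ H : Polynomial ℚ}

/-- First component of the chart. -/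
@[simp] theorem vΦ_zero (p : Fin 2 → ℝ) : vΦ m Y₀ H p 0 = p 1 := rfl

/-- Second component of the chart. -/
@[simp] theorem vΦ_one (p : Fin 2 → ℝ) :
    vΦ m Y₀ H p 1 = Polynomial.aeval (p 1) Y₀ + vS H (p 1) * gU m (p 0) := rfl

/-- `D ∘ Φ = H(x)·T_m(v)²`. -/
theorem D_vΦ (hm : 0 ≤ m) (p : Fin 2 → ℝ) (hx : 0 ≤ Polynomial.aeval (p 1) H) :
    Polynomial.aeval (p 1) H - m * (vΦ m Y₀ H p 1 - Polynomial.aeval (p 1) Y₀) ^ 2 =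
      Polynomial.aeval (p 1) H * gT m (p 0) ^ 2 := by
  rw [vΦ_one, add_sub_cancel_left, mul_pow, vS_sq hx, ← one_sub_m_gU_sq hm]
  ring

/-- `√D ∘ Φ = √H(x)·T_m(v)` for `m v² ≤ 1`. -/
theorem sqrt_D_vΦ (hm : 0 ≤ m) (p : Fin 2 → ℝ) (hx : 0 ≤ Polynomial.aeval (p 1) H)
    (hv : (m : ℝ) * p 0 ^ 2 ≤ 1) :
    √(Polynomial.aeval (p 1) H - m * (vΦ m Y₀ H p 1 - Polynomial.aeval (p 1) Y₀) ^ 2) =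
      vS H (p 1) * gT m (p 0) := by
  rw [D_vΦ hm p hx, Real.sqrt_mul hx, Real.sqrt_sq (gT_nonneg hm hv)]
  rfl

/-- Jacobian matrix of `Φ` (rows `x, y`; columns `v, x`). -/
def vMat (m : ℚ) (Y₀ H : Polynomial ℚ) (p : Fin 2 → ℝ) : Matrix (Fin 2) (Fin 2) ℝ :=
  !![0, 1;
     vS H (p 1) * gU' m (p 0),
       Polynomial.aeval (p 1) (Polynomial.derivative Y₀) +
         Polynomial.aeval (p 1) (Polynomial.derivative H) / (2 * vS H (p 1)) * gU m (p 0)]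

/-- The derivative of `Φ` at `p` as a continuous linear map. -/
def vΦ' (m : ℚ) (Y₀ H : Polynomial ℚ) (p : Fin 2 → ℝ) : (Fin 2 → ℝ) →L[ℝ] (Fin 2 → ℝ) :=
  LinearMap.toContinuousLinearMap (Matrix.toLin' (vMat m Y₀ H p))

/-- Matrix form of `Φ'`. -/
theorem vΦ'_apply (p v : Fin 2 → ℝ) (a : Fin 2) :
    vΦ' m Y₀ H p v a = ∑ b, vMat m Y₀ H p a b * v b := by
  change Matrix.toLin' (vMat m Y₀ H p) v a = _
  rw [Matrix.toLin'_apply]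
  rfl

/-- `det Φ'(v, x) = −√H(x)·U_m′(v)`. -/
theorem vΦ'_det (p : Fin 2 → ℝ) : (vΦ' m Y₀ H p).det = -(vS H (p 1) * gU' m (p 0)) := by
  change LinearMap.det (Matrix.toLin' (vMat m Y₀ H p)) = _
  rw [LinearMap.det_toLin', Matrix.det_fin_two]
  simp only [vMat, Matrix.of_apply, Matrix.cons_val', Matrix.cons_val_zero, Matrix.cons_val_one,
    Matrix.cons_val_fin_one, Matrix.empty_val']
  ring

/-- `Φ` is differentiable where `H > 0`, with derivative `Φ'`. [calculus] -/
theorem hasFDerivAt_vΦ (hm : 0 ≤ m) (p : Fin 2 → ℝ) (hp : 0 < Polynomial.aeval (p 1) H) :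
    HasFDerivAt (vΦ m Y₀ H) (vΦ' m Y₀ H p) p := by
  have hπ0 : HasFDerivAt (𝕜 := ℝ) (fun y : Fin 2 → ℝ => y 0)
      (ContinuousLinearMap.proj (R := ℝ) (φ := fun _ : Fin 2 => ℝ) 0) p := hasFDerivAt_apply 0 p
  have hπ1 : HasFDerivAt (𝕜 := ℝ) (fun y : Fin 2 → ℝ => y 1)
      (ContinuousLinearMap.proj (R := ℝ) (φ := fun _ : Fin 2 => ℝ) 1) p := hasFDerivAt_apply 1 p
  have hE : HasFDerivAt (fun y : Fin 2 → ℝ => vS H (y 1))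
      ((Polynomial.aeval (p 1) (Polynomial.derivative H) / (2 * vS H (p 1))) •
        ContinuousLinearMap.proj (R := ℝ) (φ := fun _ : Fin 2 => ℝ) 1) p :=
    HasDerivAt.comp_hasFDerivAt (h₂ := vS H) p (hasDerivAt_vS hp) hπ1
  have hY : HasFDerivAt (fun y : Fin 2 → ℝ => Polynomial.aeval (y 1) Y₀)
      ((Polynomial.aeval (p 1) (Polynomial.derivative Y₀)) •
        ContinuousLinearMap.proj (R := ℝ) (φ := fun _ : Fin 2 => ℝ) 1) p :=
    HasDerivAt.comp_hasFDerivAt (h₂ := fun x : ℝ => Polynomial.aeval x Y₀) p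
      (Y₀.hasDerivAt_aeval (p 1)) hπ1
  have hT : HasFDerivAt (fun y : Fin 2 → ℝ => gU m (y 0))
      ((gU' m (p 0)) • ContinuousLinearMap.proj (R := ℝ) (φ := fun _ : Fin 2 => ℝ) 0) p :=
    HasDerivAt.comp_hasFDerivAt (h₂ := gU m) p (hasDerivAt_gU hm (p 0)) hπ0
  have h0 : HasFDerivAt (fun y : Fin 2 → ℝ => vΦ m Y₀ H y 0)
      ((ContinuousLinearMap.proj 0).comp (vΦ' m Y₀ H p)) p := by
    have hf : (fun y : Fin 2 → ℝ => vΦ m Y₀ H y 0) = fun y => y 1 := funext vΦ_zero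
    rw [hf]
    refine hπ1.congr_fderiv (ContinuousLinearMap.ext fun v => ?_)
    simp [vΦ'_apply, vMat, Fin.sum_univ_two]
  have h1 : HasFDerivAt (fun y : Fin 2 → ℝ => vΦ m Y₀ H y 1)
      ((ContinuousLinearMap.proj 1).comp (vΦ' m Y₀ H p)) p := by
    have hf : (fun y : Fin 2 → ℝ => vΦ m Y₀ H y 1) =
        fun y => Polynomial.aeval (y 1) Y₀ + vS H (y 1) * gU m (y 0) := funext vΦ_one
    rw [hf]
    refine (hY.add (hE.mul hT)).congr_fderiv (ContinuousLinearMap.ext fun v => ?_)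
    simp [vΦ'_apply, vMat, Fin.sum_univ_two, smul_eq_mul]
    ring
  refine hasFDerivAt_pi'' fun a => ?_
  fin_cases a
  · exact h0
  · exact h1

/-- `Φ` is injective on `{m v² < 1, H(x) > 0}`. -/
theorem injOn_vΦ (hm : 0 ≤ m) :
    InjOn (vΦ m Y₀ H) {p | (m : ℝ) * p 0 ^ 2 < 1 ∧ 0 < Polynomial.aeval (p 1) H} := by
  intro p hp q hq hpq
  have hx : p 1 = q 1 := by simpa using congrFun hpq 0
  have hs : 0 < vS H (p 1) := vS_pos hp.2
  have hy : Polynomial.aeval (p 1) Y₀ + vS H (p 1) * gU m (p 0) =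
      Polynomial.aeval (p 1) Y₀ + vS H (p 1) * gU m (q 0) := by
    have h := congrFun hpq 1
    simp only [vΦ_one] at h
    rwa [← hx] at h
  have hy' := mul_left_cancel₀ hs.ne' (add_left_cancel hy)
  have hq' : (m : ℝ) * q 0 ^ 2 < 1 := hq.1
  have hv : p 0 = q 0 := gU_inj hm hp.1 hq' hy'
  funext j
  fin_cases j
  · exact hv
  · exact hx

/-- A one-variable polynomial in the `i`-th coordinate, as a two-variable polynomial, evaluates
as expected. -/
theorem aeval_polyX (p : Fin 2 → ℝ) (P : Polynomial ℚ) (i : Fin 2) :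
    aeval p (Polynomial.aeval (X i : MvPolynomial (Fin 2) ℚ) P) = Polynomial.aeval (p i) P := by
  rw [← Polynomial.aeval_algHom_apply, MvPolynomial.aeval_X]

/-- `Φ` is a `ℚ`-semialgebraic map on every `ℚ`-semialgebraic set. [BCR1998 §2.2] -/
theorem isSemialgebraicMapOn_vΦ (hm : 0 ≤ m) {S : Set (Fin 2 → ℝ)} (hS : IsSemialgebraic ℚ S) :
    IsSemialgebraicMapOn ℚ S (vΦ m Y₀ H) := by
  refine IsSemialgebraicMapOn.of_forall hS fun j => ?_
  fin_cases j
  · exact (isSemialgebraicFunOn_apply hS 1).congr fun p _ => by simp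
  · have hU : IsSemialgebraicFunOn ℚ S fun p => gU m (p 0) :=
      (isSemialgebraicFunOn_aeval_div_aeval hS (C 2 * X 0) (1 + C m * X 0 ^ 2) fun p _ => by
        have h := (one_add_pos hm (p 0)).ne'
        simpa using h).congr fun p _ => by
          simp [gU]
    exact ((isSemialgebraicFunOn_aeval hS (Polynomial.aeval (X 1) Y₀)).add_holds
      ((IsSemialgebraicFunOn.sqrt_holds (isSemialgebraicFunOn_aeval hS (Polynomial.aeval (X 1) H))).mul_holds
        hU)).congr fun p _ => by
          simp only [Pi.add_apply, Pi.mul_apply, aeval_polyX]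
          rfl

/-! #### 25.3 Rule (2): `[S, γ·H(x)·g_m(v)] ≡ [Φ(S), γ·√(H(x) − m(y − Y₀(x))²)]` -/

/-- The source weight `γ·H(x)·g_m(v)` is `ℚ`-semialgebraic (rational). -/
theorem isSemialgebraicFunOn_weight (hm : 0 ≤ m) {S : Set (Fin 2 → ℝ)} (hS : IsSemialgebraic ℚ S)
    (γ : ℚ) : IsSemialgebraicFunOn ℚ S fun p => (γ : ℝ) * Polynomial.aeval (p 1) H * gW m (p 0) :=
  (isSemialgebraicFunOn_aeval_div_aeval hS
      (C γ * Polynomial.aeval (X 1) H * (C 2 * (1 - C m * X 0 ^ 2) ^ 2)) ((1 + C m * X 0 ^ 2) ^ 3)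
      fun p _ => by
        have h : (0:ℝ) < (1 + (m : ℝ) * p 0 ^ 2) ^ 3 := pow_pos (one_add_pos hm (p 0)) 3
        simpa using h.ne').congr fun p _ => by
    simp only [map_mul, map_sub, map_pow, map_add, map_one, MvPolynomial.aeval_C,
      MvPolynomial.aeval_X, eq_ratCast, aeval_polyX, gW]
    push_cast
    ring

/-- The target weight `γ·√(H(x) − m(y − Y₀(x))²)` is `ℚ`-semialgebraic. [BCR1998 §2.2] -/
theorem isSemialgebraicFunOn_sqrtD {T : Set (Fin 2 → ℝ)} (hT : IsSemialgebraic ℚ T) (γ : ℚ) :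
    IsSemialgebraicFunOn ℚ T fun u =>
      (γ : ℝ) * √(Polynomial.aeval (u 0) H - m * (u 1 - Polynomial.aeval (u 0) Y₀) ^ 2) :=
  (IsSemialgebraicFunOn.mul_holds (isSemialgebraicFunOn_ratCast hT γ)
    (IsSemialgebraicFunOn.sqrt_holds (isSemialgebraicFunOn_aeval hT
      (Polynomial.aeval (X 0) H - C m * (X 1 - Polynomial.aeval (X 0) Y₀) ^ 2)))).congr fun u _ => by
    simp only [Pi.mul_apply, map_sub, map_mul, map_pow, MvPolynomial.aeval_C, MvPolynomial.aeval_X,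
      eq_ratCast, aeval_polyX]

/-- `[S, γ·H(x)·g_m(v)]` on a bounded piece `S` of the chart plane where `|H(x)| ≤ M`. -/
def srcRep (m : ℚ) (hm : 0 ≤ m) (H : Polynomial ℚ) (γ : ℚ) (S : Set (Fin 2 → ℝ))
    (hS : IsSemialgebraic ℚ S) (hSb : Bornology.IsBounded S) (M : ℝ)
    (hM : ∀ p ∈ S, |Polynomial.aeval (p 1) H| ≤ M) : KZ.IntegralRep 2 :=
  bddRep S hS hSb (fun p => (γ : ℝ) * Polynomial.aeval (p 1) H * gW m (p 0))
    (isSemialgebraicFunOn_weight hm hS γ) (|(γ : ℝ)| * M * 2) fun p hp => by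
      rw [abs_mul, abs_mul, abs_of_nonneg (gW_nonneg hm _)]
      have hM0 : 0 ≤ M := (abs_nonneg _).trans (hM p hp)
      exact mul_le_mul (mul_le_mul_of_nonneg_left (hM p hp) (abs_nonneg _)) (gW_le_two hm (p 0))
        (gW_nonneg hm _) (by positivity)

/-- Domain of `srcRep`. -/
@[simp] theorem srcRep_domain (hm : 0 ≤ m) (γ : ℚ) (S : Set (Fin 2 → ℝ)) (hS : IsSemialgebraic ℚ S)
    (hSb : Bornology.IsBounded S) (M : ℝ) (hM : ∀ p ∈ S, |Polynomial.aeval (p 1) H| ≤ M) :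
    (srcRep m hm H γ S hS hSb M hM).domain = S := rfl

/-- Integrand of `srcRep`. -/
@[simp] theorem srcRep_integrand (hm : 0 ≤ m) (γ : ℚ) (S : Set (Fin 2 → ℝ))
    (hS : IsSemialgebraic ℚ S) (hSb : Bornology.IsBounded S) (M : ℝ)
    (hM : ∀ p ∈ S, |Polynomial.aeval (p 1) H| ≤ M) (p : Fin 2 → ℝ) :
    (srcRep m hm H γ S hS hSb M hM).integrand p =
      (γ : ℝ) * Polynomial.aeval (p 1) H * gW m (p 0) := rfl

/-- `[T, γ·√(H(x) − m(y − Y₀(x))²)]` on a bounded piece `T` of the `(x, y)`-plane with `|H(x)| ≤ M`. -/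
def tgtRep (m : ℚ) (hm : 0 ≤ m) (Y₀ H : Polynomial ℚ) (γ : ℚ) (T : Set (Fin 2 → ℝ))
    (hT : IsSemialgebraic ℚ T) (hTb : Bornology.IsBounded T) (M : ℝ)
    (hM : ∀ u ∈ T, |Polynomial.aeval (u 0) H| ≤ M) : KZ.IntegralRep 2 :=
  bddRep T hT hTb
    (fun u => (γ : ℝ) * √(Polynomial.aeval (u 0) H - m * (u 1 - Polynomial.aeval (u 0) Y₀) ^ 2))
    (isSemialgebraicFunOn_sqrtD hT γ) (|(γ : ℝ)| * √M) fun u hu => by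
      rw [abs_mul, abs_of_nonneg (Real.sqrt_nonneg _)]
      refine mul_le_mul_of_nonneg_left (Real.sqrt_le_sqrt ?_) (abs_nonneg _)
      have hm' : (0 : ℝ) ≤ m := by exact_mod_cast hm
      nlinarith [le_abs_self (Polynomial.aeval (u 0) H), hM u hu,
        mul_nonneg hm' (sq_nonneg (u 1 - Polynomial.aeval (u 0) Y₀))]

/-- Domain of `tgtRep`. -/
@[simp] theorem tgtRep_domain (hm : 0 ≤ m) (γ : ℚ) (T : Set (Fin 2 → ℝ)) (hT : IsSemialgebraic ℚ T)
    (hTb : Bornology.IsBounded T) (M : ℝ) (hM : ∀ u ∈ T, |Polynomial.aeval (u 0) H| ≤ M) :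
    (tgtRep m hm Y₀ H γ T hT hTb M hM).domain = T := rfl

/-- Integrand of `tgtRep`. -/
@[simp] theorem tgtRep_integrand (hm : 0 ≤ m) (γ : ℚ) (T : Set (Fin 2 → ℝ))
    (hT : IsSemialgebraic ℚ T) (hTb : Bornology.IsBounded T) (M : ℝ)
    (hM : ∀ u ∈ T, |Polynomial.aeval (u 0) H| ≤ M) (u : Fin 2 → ℝ) :
    (tgtRep m hm Y₀ H γ T hT hTb M hM).integrand u =
      (γ : ℝ) * √(Polynomial.aeval (u 0) H - m * (u 1 - Polynomial.aeval (u 0) Y₀) ^ 2) := rfl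

end Summit.KontsevichZagierPeriods.RootDecompWalshStrata.ConicDescent.VertexChart
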